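import Summits.ABC.IUTFork.ForkGenuineContent
import Literature.IUT.LogVolume.TensorPacketContentVolume
import HarnessLib

/-!
# The fork at [IUTchIII] Corollary 3.12 at a GENUINE input: the GLOBAL two-sided window for `−|log(Θ)|` and the
# width of the undecided band — exactly the log-different term (skeleton XXVIIc, global-window half)

Record-only file (D-0012) of the abc-iut cell (deliverable (a), skeleton seat abc-iut-skel, gen 7); TAKES NO SIDE.
Sequel to `ForkGenuineContent.lean` (p424877; per-summand content formula at the objects DEFINING the genuine
`−|log(Θ)|` of a Θ-volume input `I : ThetaVolumeInput F₀ K` — whose exact-formula half is the skeleton twin of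
abc-iut-c312-3's `GenuineLogThetaExactVolume(Input)` p422788/p424014, OF RECORD) and to `ForkGenuineRegimes.lean`
(p425602: the coarse SHALLOW/DEEP thresholds `κ_l·deĝ̲(𝔮) ≤ ((l+5)/4)·log π ⟹ Cor312Of I ⟹ κ_l·deĝ̲(𝔮) ≤ δΣ(I) +
((l+5)/4)·log π`). HERE abc-iut-w5-d082's summand-level VOLUME WINDOW (`TensorPacketContentVolume` p424063, packet
level, any bounded region: `log‖g‖ + δ_Λ ≤ log μ̄(hull(⋃_γ γ·M)) ≤ log‖g_{i₀}‖ + δ_Λ + {d_I + 1 + 4|I*|/p}·log p`,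
`δ_Λ := log μ̄(hull(log_p(R_I^×))) − log μ̄(log_p(R_I^×)) ≥ 0` the HULL DEFECT of the log-shell lattice, upper end =
[IUTchIV] Prop. 1.4 (iii) FIRST displayed inequality, abc-iut-S8's `Prop14iii₁_holds`) is read at the input's slot
unions and SUMMED over the support primes `T(I)` with Dupuy–Hilado's weights `Π_k Pr(v_k)` and the procession
average `1/ℓ⋇` (Def. 3.6.3; [IUTchIV] Thm. 1.10 Steps (iv)/(viii) "it suffices to sum over `v_ℚ ∈ 𝕍_ℚ` the various
local … bounds"). With `θ_j(v) := P_{Θ,j}(v)·ln|κ(v)|/n_v` (so `log‖t_{Θ,j,v}‖ = −θ_j(v)`, `GenuineContent.log_norm_tΘ`):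

* `neg_theta_add_defect_le_logμ` — per summand, EVERY slot `a`: `−θ_j(v_a) + δ_Λ(v⃗) ≤ log μ̄_{v⃗}(Θ-hull)`;
  `logμ_le_neg_thetaMin_add_first` — `log μ̄_{v⃗}(Θ-hull) ≤ −min_a θ_j(v_a) + δ_Λ(v⃗) + {d_I + 1 + 4|I*|/p}·log p`
  with `I* :=` the slots of ramification `> p − 2` (no tameness assumed);
* **`lowerWindow_le_negLogThetaNonarch`** / **`negLogThetaNonarch_le_upperWindow`** — the GLOBAL window:
  `Σ_{p∈T(I)} (1/ℓ⋇)·Σ_j Σ_{v⃗} (−min_a θ_j(v_a) + δ_Λ(v⃗))·Π Pr ≤ negLogThetaNonarch I ≤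
   Σ_{p∈T(I)} (1/ℓ⋇)·Σ_j Σ_{v⃗} (−min_a θ_j(v_a) + δ_Λ(v⃗) + {d_I + 1 + 4|I*|/p}·log p)·Π Pr` — unconditional;
* `upperWindow_sub_lowerWindow` — the two ends differ by EXACTLY the log-different term
  `D(I) := Σ_{p∈T(I)} (1/ℓ⋇)·Σ_j Σ_{v⃗} {d_I + 1 + 4|I*|/p}·log p·Π Pr` ([IUTchIV] (1.4) (iii)'s `{d_I + 1 + 4|I*|/p}`);
* `sum_neg_theta_last_eq` — Dupuy–Hilado Thm. 3.10.1 for the input in this currency: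
  `Σ_p (1/ℓ⋇)·Σ_j Σ_{v⃗} (−θ_j(v_j))·Π Pr = −deĝ̲_lgp(P_Θ)` (abc-iut-c312-3's `DHData.lnνL_regionΘ` through S2's bridge),
  hence `lowerWindow ≥ −deĝ̲_lgp(P_Θ) + Δ_Λ(I)` (`neg_ndegLgp_add_defect_le_lowerWindow`, `Δ_Λ(I) := Σ … δ_Λ·Π Pr ≥ 0`);
* the REFINED REGIMES: **`cor312Of_of_le_lowerWindow`** (`−deĝ̲(P_q) ≤ lowerWindow + ((l+5)/4)·log π ⟹ Cor312Of I`
  — a weaker hypothesis than `cor312Of_of_shallow`'s `κ_l·deĝ̲(𝔮) ≤ ((l+5)/4)·log π`, since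
  `lowerWindow ≥ −deĝ̲_lgp(P_Θ) + Δ_Λ(I) ≥ −deĝ̲_lgp(P_Θ)` by `0 ≤ δ_Λ`),
  **`negAbsLogQ_le_upperWindow_of_cor312Of`** (`Cor312Of I ⟹ −deĝ̲(P_q) ≤ upperWindow + ((l+5)/4)·log π`): the set
  of values of `−deĝ̲(P_q)` on which `Cor312Of I` is NOT decided by these two kernel facts is a band of width `D(I)` —
  the log-different/ramification budget — sitting at `lowerWindow + ((l+5)/4)·log π`; inside it the lattice contents
  decide (c312-3's `cor312Of_iff_of_content`).

HONEST SCOPE: sharp (Ind3), full (Ind1)/(Ind2), genuine completions, Mochizuki's container as shell (the shell never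
enters these numbers); `δ_Λ`, `log μ̄(log_p(R_I^×))` are left as terms (their evaluation is [IUTchIV] Prop. 1.4
bookkeeping; `0 ≤ δ_Λ`, w5-d082's `packetLogμ_logPacket_le_packetHull`). (Ind1)/(Ind2)/hull/possible images are the
tree's typings of the disputed corpus [claim: Mochizuki2012, status: disputed]; the volume algebra is classical.
`Cor312Of` is asserted ONLY under the stated lower-window hypothesis; nothing is claimed about which band the Θ-data
of a given curve occupy; no side is taken on [IUTchIII] Cor. 3.12; typed ≠ proved. PROOF-ONLY file.
[cite: DupuyHilado2025, Def. 3.6.3, Thm. 3.10.1, §4.9, §4.12] [cite: Mochizuki2012, IUTchIV Prop. 1.4 (iii) p. 13]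
[cite: Mochizuki2012, IUTchIV Thm. 1.10 Steps (iv)–(viii) p. 26–30] [cite: Mochizuki2012, IUTchIII Cor. 3.12 p. 173–174]
-/

noncomputable section

open Set Literature.IUT.LogVolume NumberField IsDedekindDomain
open scoped Pointwise

namespace Summit.ABC.IUTFork.GenuineContent

section Window

variable {F₀ : Type} [Field F₀] [NumberField F₀] {K : Type} [Field K] [NumberField K] [Algebra F₀ K]
variable (I : ThetaVolumeInput F₀ K)

/-! ## 1. Per summand of the input's real packets: w5-d082's volume window in θ-currency -/

/-- **Lower end with the hull defect, EVERY slot**: `−θ_j(v_a) + δ_Λ(v⃗) ≤ log μ̄_{v⃗}(Θ-hull)` (the bare Θ-region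
of slot `a` lies in the slot-union, w5-d082's `packetLogμ_packetHull_orbit_ge_defect`).
[cite: DupuyHilado2025, §4.9, §4.12] -/
theorem neg_theta_add_defect_le_logμ {p : ℕ} [hp : Fact p.Prime] (i : Fin I.X.lstar)
    (e : Fin ((i : ℕ) + 1 + 1) → placesOver F₀ p) (a : Fin ((i : ℕ) + 1 + 1)) :
    -(I.X.thetaPilot i (e a).1 * logNorm F₀ (e a).1 / localDegree F₀ (e a).1)
        + (packetLogμ p (fun b => (I.σ.localFieldFamily p hp.out).k (e b))
            (packetHull p (fun b => (I.σ.localFieldFamily p hp.out).k (e b))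
              (logPacket p (fun b => (I.σ.localFieldFamily p hp.out).k (e b)) : Set _))
          - packetLogμ p (fun b => (I.σ.localFieldFamily p hp.out).k (e b))
            (logPacket p (fun b => (I.σ.localFieldFamily p hp.out).k (e b)) : Set _)) ≤
      (realPrimePacketM p (I.σ.localFieldFamily p hp.out)).logμ
        ((realPrimePacketM p (I.σ.localFieldFamily p hp.out)).possibleImagesHull
          ((realPrimePacketM p (I.σ.localFieldFamily p hp.out)).pilotRegion (I.tΘ p hp.out))
            ((i : ℕ) + 1) e) := by
  have hw := packetLogμ_packetHull_orbit_ge_defect p (fun b => (I.σ.localFieldFamily p hp.out).k (e b))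
    (isPsiBounded_slotUnion (I.σ.localFieldFamily p hp.out) (I.tΘ p hp.out) i e) (I.tΘ p hp.out i (e a)).ne_zero
    (Set.subset_iUnion (fun a : Fin ((i : ℕ) + 1 + 1) =>
      iota p (fun b => (I.σ.localFieldFamily p hp.out).k (e b)) a
        (I.tΘ p hp.out i (e a) : (I.σ.localFieldFamily p hp.out).k (e a)) •
        (normalizedPacket p (fun b => (I.σ.localFieldFamily p hp.out).k (e b)) :
          Set (PacketAlgebra p (fun b => (I.σ.localFieldFamily p hp.out).k (e b))))) a)
  have heq : (realPrimePacketM p (I.σ.localFieldFamily p hp.out)).possibleImagesHull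
        ((realPrimePacketM p (I.σ.localFieldFamily p hp.out)).pilotRegion (I.tΘ p hp.out)) ((i : ℕ) + 1) e =
      packetHull p (fun b => (I.σ.localFieldFamily p hp.out).k (e b))
        (⋃ γ : indTwo p (fun b => (I.σ.localFieldFamily p hp.out).k (e b)),
          γ • ⋃ a : Fin ((i : ℕ) + 1 + 1), iota p (fun b => (I.σ.localFieldFamily p hp.out).k (e b)) a
            (I.tΘ p hp.out i (e a) : (I.σ.localFieldFamily p hp.out).k (e a)) •
            (normalizedPacket p (fun b => (I.σ.localFieldFamily p hp.out).k (e b)) :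
              Set (PacketAlgebra p (fun b => (I.σ.localFieldFamily p hp.out).k (e b))))) :=
    possibleImagesHull_pilotRegion_eq (I.σ.localFieldFamily p hp.out) (mScale p _) (mScale_ne_zero p _)
      (mScale_perm p _) (I.tΘ p hp.out) i e
  show _ ≤ packetLogμ p (fun b => (I.σ.localFieldFamily p hp.out).k (e b))
    ((realPrimePacketM p (I.σ.localFieldFamily p hp.out)).possibleImagesHull
      ((realPrimePacketM p (I.σ.localFieldFamily p hp.out)).pilotRegion (I.tΘ p hp.out)) ((i : ℕ) + 1) e)
  rw [heq, ← log_norm_tΘ I i (e a)]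
  exact hw

/-- **Upper end in the first-inequality currency**: `log μ̄_{v⃗}(Θ-hull) ≤ −min_a θ_j(v_a) + δ_Λ(v⃗) +
{d_I + 1 + 4|I*|/p}·log p`, `I* :=` the slots with `e_a > p − 2` (w5-d082's `packetLogμ_packetHull_orbit_le_first'`
at the slot-union, the slot of least `θ` having the largest norm). [cite: Mochizuki2012, IUTchIV Prop. 1.4 (iii) p. 13] -/
theorem logμ_le_neg_thetaMin_add_first {p : ℕ} [hp : Fact p.Prime] (i : Fin I.X.lstar)
    (e : Fin ((i : ℕ) + 1 + 1) → placesOver F₀ p) :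
    (realPrimePacketM p (I.σ.localFieldFamily p hp.out)).logμ
        ((realPrimePacketM p (I.σ.localFieldFamily p hp.out)).possibleImagesHull
          ((realPrimePacketM p (I.σ.localFieldFamily p hp.out)).pilotRegion (I.tΘ p hp.out))
            ((i : ℕ) + 1) e) ≤
      -(Finset.univ.inf' ⟨0, Finset.mem_univ _⟩ (fun a =>
          I.X.thetaPilot i (e a).1 * logNorm F₀ (e a).1 / localDegree F₀ (e a).1))
        + (packetLogμ p (fun b => (I.σ.localFieldFamily p hp.out).k (e b))
            (packetHull p (fun b => (I.σ.localFieldFamily p hp.out).k (e b))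
              (logPacket p (fun b => (I.σ.localFieldFamily p hp.out).k (e b)) : Set _))
          - packetLogμ p (fun b => (I.σ.localFieldFamily p hp.out).k (e b))
            (logPacket p (fun b => (I.σ.localFieldFamily p hp.out).k (e b)) : Set _))
        + (dSum p (fun b => (I.σ.localFieldFamily p hp.out).k (e b)) + 1
            + 4 * ((Finset.univ.filter (fun a : Fin ((i : ℕ) + 1 + 1) =>
                p - 2 < absRamificationIdx p ((I.σ.localFieldFamily p hp.out).k (e a)))).card : ℝ) / p)
          * Real.log p := by
  have hI : 2 ≤ Fintype.card (Fin ((i : ℕ) + 1 + 1)) := by simp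
  obtain ⟨a₀, -, ha₀⟩ := Finset.exists_mem_eq_inf' (⟨0, Finset.mem_univ _⟩ : (Finset.univ :
    Finset (Fin ((i : ℕ) + 1 + 1))).Nonempty)
    (fun a => I.X.thetaPilot i (e a).1 * logNorm F₀ (e a).1 / localDegree F₀ (e a).1)
  have hmin : ∀ a, I.X.thetaPilot i (e a₀).1 * logNorm F₀ (e a₀).1 / localDegree F₀ (e a₀).1 ≤
      I.X.thetaPilot i (e a).1 * logNorm F₀ (e a).1 / localDegree F₀ (e a).1 := fun a => by
    rw [← ha₀]
    exact Finset.inf'_le _ (Finset.mem_univ a)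
  have hmax : ∀ a, ‖(I.tΘ p hp.out i (e a) : (I.σ.localFieldFamily p hp.out).k (e a))‖ ≤
      ‖(I.tΘ p hp.out i (e a₀) : (I.σ.localFieldFamily p hp.out).k (e a₀))‖ := by
    intro a
    rw [← Real.log_le_log_iff (norm_pos_iff.mpr (I.tΘ p hp.out i (e a)).ne_zero)
      (norm_pos_iff.mpr (I.tΘ p hp.out i (e a₀)).ne_zero), log_norm_tΘ, log_norm_tΘ]
    exact neg_le_neg (hmin a)
  choose mexp hmexp using fun a =>
    exists_norm_eq_rpow p ((I.σ.localFieldFamily p hp.out).k (e a)) (I.tΘ p hp.out i (e a)).ne_zero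
  have hmin' : ∀ a, (mexp a₀ : ℝ) / absRamificationIdx p ((I.σ.localFieldFamily p hp.out).k (e a₀)) ≤
      (mexp a : ℝ) / absRamificationIdx p ((I.σ.localFieldFamily p hp.out).k (e a)) :=
    fun a => slotOrder_le_of_norm_le p (fun b => (I.σ.localFieldFamily p hp.out).k (e b))
      (hmexp a) (hmexp a₀) (hmax a)
  have hw := packetLogμ_packetHull_orbit_le_first' p (fun b => (I.σ.localFieldFamily p hp.out).k (e b)) hI
    (Finset.univ.filter (fun a : Fin ((i : ℕ) + 1 + 1) =>
      p - 2 < absRamificationIdx p ((I.σ.localFieldFamily p hp.out).k (e a))))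
    (fun a ha => by
      rw [Finset.mem_filter, not_and] at ha
      exact Nat.le_of_not_lt (ha (Finset.mem_univ a)))
    (isPsiBounded_slotUnion (I.σ.localFieldFamily p hp.out) (I.tΘ p hp.out) i e)
    (exists_ne_zero_mem_slotUnion (I.σ.localFieldFamily p hp.out) (I.tΘ p hp.out) i e)
    (fun a => (I.tΘ p hp.out i (e a) : (I.σ.localFieldFamily p hp.out).k (e a))) mexp hmexp a₀ hmin'
    Subset.rfl
  have heq : (realPrimePacketM p (I.σ.localFieldFamily p hp.out)).possibleImagesHull
        ((realPrimePacketM p (I.σ.localFieldFamily p hp.out)).pilotRegion (I.tΘ p hp.out)) ((i : ℕ) + 1) e =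
      packetHull p (fun b => (I.σ.localFieldFamily p hp.out).k (e b))
        (⋃ γ : indTwo p (fun b => (I.σ.localFieldFamily p hp.out).k (e b)),
          γ • ⋃ a : Fin ((i : ℕ) + 1 + 1), iota p (fun b => (I.σ.localFieldFamily p hp.out).k (e b)) a
            (I.tΘ p hp.out i (e a) : (I.σ.localFieldFamily p hp.out).k (e a)) •
            (normalizedPacket p (fun b => (I.σ.localFieldFamily p hp.out).k (e b)) :
              Set (PacketAlgebra p (fun b => (I.σ.localFieldFamily p hp.out).k (e b))))) :=
    possibleImagesHull_pilotRegion_eq (I.σ.localFieldFamily p hp.out) (mScale p _) (mScale_ne_zero p _)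
      (mScale_perm p _) (I.tΘ p hp.out) i e
  show packetLogμ p (fun b => (I.σ.localFieldFamily p hp.out).k (e b))
    ((realPrimePacketM p (I.σ.localFieldFamily p hp.out)).possibleImagesHull
      ((realPrimePacketM p (I.σ.localFieldFamily p hp.out)).pilotRegion (I.tΘ p hp.out)) ((i : ℕ) + 1) e) ≤ _
  rw [heq, ha₀, ← log_norm_tΘ I i (e a₀)]
  exact hw

/-! ## 2. The GLOBAL window (summed over `T(I)` with `Π Pr` and `1/ℓ⋇`) -/

/-- The weights `Π_k Pr(v_k)` are nonnegative. [cite: DupuyHilado2025, §3.6] -/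
theorem prod_weight_nonneg {p : ℕ} {n : ℕ} (e : Fin n → placesOver F₀ p) : 0 ≤ ∏ b, weight F₀ (e b).1 :=
  Finset.prod_nonneg fun b _ => weight_nonneg F₀ (e b).1

/-- `1/ℓ⋇ ≥ 0`. [cite: DupuyHilado2025, §3.3] -/
theorem one_div_lstar_nonneg : (0 : ℝ) ≤ 1 / (I.X.lstar : ℝ) := by positivity
/-- **GLOBAL LOWER END**: `Σ_{p∈T(I)} (1/ℓ⋇)·Σ_j Σ_{v⃗} (−min_a θ_j(v_a) + δ_Λ(v⃗))·Π Pr ≤ negLogThetaNonarch I` — the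
free inequality sharpened by the (Ind1)-slot term AND the hull defects. Unconditional.
[cite: DupuyHilado2025, Def. 3.6.3, §4.12] -/
theorem lowerWindow_le_negLogThetaNonarch :
    ∑ p ∈ I.supportPrimes, (1 / (I.X.lstar : ℝ)) * ∑ i : Fin I.X.lstar,
        ∑ e : Fin ((i : ℕ) + 1 + 1) → placesOver F₀ p,
          (if hp : p.Prime then
            haveI : Fact p.Prime := ⟨hp⟩
            (-(Finset.univ.inf' ⟨0, Finset.mem_univ _⟩ (fun a =>
                I.X.thetaPilot i (e a).1 * logNorm F₀ (e a).1 / localDegree F₀ (e a).1))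
              + (packetLogμ p (fun b => (I.σ.localFieldFamily p hp).k (e b))
                  (packetHull p (fun b => (I.σ.localFieldFamily p hp).k (e b))
                    (logPacket p (fun b => (I.σ.localFieldFamily p hp).k (e b)) : Set _))
                - packetLogμ p (fun b => (I.σ.localFieldFamily p hp).k (e b))
                  (logPacket p (fun b => (I.σ.localFieldFamily p hp).k (e b)) : Set _)))
           else 0) * ∏ b, weight F₀ (e b).1 ≤
      I.negLogThetaNonarch := by
  unfold ThetaVolumeInput.negLogThetaNonarch
  refine Finset.sum_le_sum fun p hpT => ?_
  have hp' : p.Prime := I.prime_of_mem_supportPrimes hpT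
  haveI hp : Fact p.Prime := ⟨hp'⟩
  simp only [dif_pos hp']
  rw [negLogThetaLoc_eq_sum]
  refine mul_le_mul_of_nonneg_left (Finset.sum_le_sum fun i _ => Finset.sum_le_sum fun e _ =>
    mul_le_mul_of_nonneg_right ?_ (prod_weight_nonneg e)) (one_div_lstar_nonneg I)
  obtain ⟨a₀, -, ha₀⟩ := Finset.exists_mem_eq_inf' (⟨0, Finset.mem_univ _⟩ : (Finset.univ :
    Finset (Fin ((i : ℕ) + 1 + 1))).Nonempty)
    (fun a => I.X.thetaPilot i (e a).1 * logNorm F₀ (e a).1 / localDegree F₀ (e a).1)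
  rw [ha₀]
  exact neg_theta_add_defect_le_logμ I i e a₀

/-- **GLOBAL UPPER END** (first-inequality currency): `negLogThetaNonarch I ≤ Σ_{p∈T(I)} (1/ℓ⋇)·Σ_j Σ_{v⃗}
(−min_a θ_j(v_a) + δ_Λ(v⃗) + {d_I + 1 + 4|I*|/p}·log p)·Π Pr`. Unconditional.
[cite: Mochizuki2012, IUTchIV Prop. 1.4 (iii) p. 13, Thm. 1.10 Steps (v)–(viii) p. 27–30] -/
theorem negLogThetaNonarch_le_upperWindow :
    I.negLogThetaNonarch ≤
      ∑ p ∈ I.supportPrimes, (1 / (I.X.lstar : ℝ)) * ∑ i : Fin I.X.lstar,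
        ∑ e : Fin ((i : ℕ) + 1 + 1) → placesOver F₀ p,
          (if hp : p.Prime then
            haveI : Fact p.Prime := ⟨hp⟩
            (-(Finset.univ.inf' ⟨0, Finset.mem_univ _⟩ (fun a =>
                I.X.thetaPilot i (e a).1 * logNorm F₀ (e a).1 / localDegree F₀ (e a).1))
              + (packetLogμ p (fun b => (I.σ.localFieldFamily p hp).k (e b))
                  (packetHull p (fun b => (I.σ.localFieldFamily p hp).k (e b))
                    (logPacket p (fun b => (I.σ.localFieldFamily p hp).k (e b)) : Set _))
                - packetLogμ p (fun b => (I.σ.localFieldFamily p hp).k (e b))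
                  (logPacket p (fun b => (I.σ.localFieldFamily p hp).k (e b)) : Set _))
              + (dSum p (fun b => (I.σ.localFieldFamily p hp).k (e b)) + 1
                  + 4 * ((Finset.univ.filter (fun a : Fin ((i : ℕ) + 1 + 1) =>
                      p - 2 < absRamificationIdx p ((I.σ.localFieldFamily p hp).k (e a)))).card : ℝ) / p)
                * Real.log p)
           else 0) * ∏ b, weight F₀ (e b).1 := by
  unfold ThetaVolumeInput.negLogThetaNonarch
  refine Finset.sum_le_sum fun p hpT => ?_
  have hp' : p.Prime := I.prime_of_mem_supportPrimes hpT
  haveI hp : Fact p.Prime := ⟨hp'⟩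
  simp only [dif_pos hp']
  rw [negLogThetaLoc_eq_sum]
  refine mul_le_mul_of_nonneg_left (Finset.sum_le_sum fun i _ => Finset.sum_le_sum fun e _ =>
    mul_le_mul_of_nonneg_right ?_ (prod_weight_nonneg e)) (one_div_lstar_nonneg I)
  exact logμ_le_neg_thetaMin_add_first I i e

/-- **The width of the undecided band is EXACTLY the log-different term**: upper window − lower window
`= D(I) := Σ_{p∈T(I)} (1/ℓ⋇)·Σ_j Σ_{v⃗} {d_I + 1 + 4|I*|/p}·log p·Π Pr`. Pure bookkeeping.
[cite: Mochizuki2012, IUTchIV Prop. 1.4 (iii) p. 13] -/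
theorem upperWindow_sub_lowerWindow :
    (∑ p ∈ I.supportPrimes, (1 / (I.X.lstar : ℝ)) * ∑ i : Fin I.X.lstar,
        ∑ e : Fin ((i : ℕ) + 1 + 1) → placesOver F₀ p,
          (if hp : p.Prime then
            haveI : Fact p.Prime := ⟨hp⟩
            (-(Finset.univ.inf' ⟨0, Finset.mem_univ _⟩ (fun a =>
                I.X.thetaPilot i (e a).1 * logNorm F₀ (e a).1 / localDegree F₀ (e a).1))
              + (packetLogμ p (fun b => (I.σ.localFieldFamily p hp).k (e b))
                  (packetHull p (fun b => (I.σ.localFieldFamily p hp).k (e b))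
                    (logPacket p (fun b => (I.σ.localFieldFamily p hp).k (e b)) : Set _))
                - packetLogμ p (fun b => (I.σ.localFieldFamily p hp).k (e b))
                  (logPacket p (fun b => (I.σ.localFieldFamily p hp).k (e b)) : Set _))
              + (dSum p (fun b => (I.σ.localFieldFamily p hp).k (e b)) + 1
                  + 4 * ((Finset.univ.filter (fun a : Fin ((i : ℕ) + 1 + 1) =>
                      p - 2 < absRamificationIdx p ((I.σ.localFieldFamily p hp).k (e a)))).card : ℝ) / p)
                * Real.log p)
           else 0) * ∏ b, weight F₀ (e b).1) -
      (∑ p ∈ I.supportPrimes, (1 / (I.X.lstar : ℝ)) * ∑ i : Fin I.X.lstar,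
        ∑ e : Fin ((i : ℕ) + 1 + 1) → placesOver F₀ p,
          (if hp : p.Prime then
            haveI : Fact p.Prime := ⟨hp⟩
            (-(Finset.univ.inf' ⟨0, Finset.mem_univ _⟩ (fun a =>
                I.X.thetaPilot i (e a).1 * logNorm F₀ (e a).1 / localDegree F₀ (e a).1))
              + (packetLogμ p (fun b => (I.σ.localFieldFamily p hp).k (e b))
                  (packetHull p (fun b => (I.σ.localFieldFamily p hp).k (e b))
                    (logPacket p (fun b => (I.σ.localFieldFamily p hp).k (e b)) : Set _))
                - packetLogμ p (fun b => (I.σ.localFieldFamily p hp).k (e b))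
                  (logPacket p (fun b => (I.σ.localFieldFamily p hp).k (e b)) : Set _)))
           else 0) * ∏ b, weight F₀ (e b).1) =
      ∑ p ∈ I.supportPrimes, (1 / (I.X.lstar : ℝ)) * ∑ i : Fin I.X.lstar,
        ∑ e : Fin ((i : ℕ) + 1 + 1) → placesOver F₀ p,
          (if hp : p.Prime then
            haveI : Fact p.Prime := ⟨hp⟩
            ((dSum p (fun b => (I.σ.localFieldFamily p hp).k (e b)) + 1
                + 4 * ((Finset.univ.filter (fun a : Fin ((i : ℕ) + 1 + 1) =>
                    p - 2 < absRamificationIdx p ((I.σ.localFieldFamily p hp).k (e a)))).card : ℝ) / p)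
              * Real.log p)
           else 0) * ∏ b, weight F₀ (e b).1 := by
  rw [← Finset.sum_sub_distrib]
  refine Finset.sum_congr rfl fun p hpT => ?_
  have hp' : p.Prime := I.prime_of_mem_supportPrimes hpT
  simp only [dif_pos hp']
  rw [← mul_sub, ← Finset.sum_sub_distrib]
  refine congrArg _ (Finset.sum_congr rfl fun i _ => ?_)
  rw [← Finset.sum_sub_distrib]
  refine Finset.sum_congr rfl fun e _ => ?_
  ring

/-! ## 3. Dupuy–Hilado Thm. 3.10.1 for the input in this currency, and the refined regimes -/

/-- **Thm. 3.10.1 for the input**: `Σ_{p∈T(I)} (1/ℓ⋇)·Σ_j Σ_{v⃗} (−θ_j(v_j))·Π Pr = −deĝ̲_lgp(P_Θ)` (the last-slot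
theta values weighted and averaged ARE minus the normalised lgp-degree of the Θ-pilot divisor; c312-3's
`DHData.lnνL_regionΘ` for S2's `DHData.ofInput I`, unfolded). [cite: DupuyHilado2025, Thm. 3.10.1] -/
theorem sum_neg_theta_last_eq :
    ∑ p ∈ I.supportPrimes, (1 / (I.X.lstar : ℝ)) * ∑ i : Fin I.X.lstar,
        ∑ e : Fin ((i : ℕ) + 1 + 1) → placesOver F₀ p,
          (-(I.X.thetaPilot i (e (Fin.last _)).1 * logNorm F₀ (e (Fin.last _)).1
              / localDegree F₀ (e (Fin.last _)).1)) * ∏ b, weight F₀ (e b).1 =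
      -LgpDivisor.ndegLgp I.X.thetaPilot := by
  have h := (DHData.ofInput I).lnνL_regionΘ
  simp only [PacketModel.lnνL, PacketModel.lnνLp, PacketModel.lnνTensorPower,
    DHData.logμ_regionΘ_ofInput] at h
  exact h

/-- Hence **`−deĝ̲_lgp(P_Θ) + Δ_Λ(I) ≤ lowerWindow`** with `Δ_Λ(I) := Σ_p (1/ℓ⋇)·Σ_j Σ_{v⃗} δ_Λ(v⃗)·Π Pr` (the
minimum over slots is at most the last slot). [cite: DupuyHilado2025, Thm. 3.10.1, §4.12] -/
theorem neg_ndegLgp_add_defect_le_lowerWindow :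
    -LgpDivisor.ndegLgp I.X.thetaPilot +
        ∑ p ∈ I.supportPrimes, (1 / (I.X.lstar : ℝ)) * ∑ i : Fin I.X.lstar,
          ∑ e : Fin ((i : ℕ) + 1 + 1) → placesOver F₀ p,
            (if hp : p.Prime then
              haveI : Fact p.Prime := ⟨hp⟩
              (packetLogμ p (fun b => (I.σ.localFieldFamily p hp).k (e b))
                  (packetHull p (fun b => (I.σ.localFieldFamily p hp).k (e b))
                    (logPacket p (fun b => (I.σ.localFieldFamily p hp).k (e b)) : Set _))
                - packetLogμ p (fun b => (I.σ.localFieldFamily p hp).k (e b))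
                  (logPacket p (fun b => (I.σ.localFieldFamily p hp).k (e b)) : Set _))
             else 0) * ∏ b, weight F₀ (e b).1 ≤
      ∑ p ∈ I.supportPrimes, (1 / (I.X.lstar : ℝ)) * ∑ i : Fin I.X.lstar,
        ∑ e : Fin ((i : ℕ) + 1 + 1) → placesOver F₀ p,
          (if hp : p.Prime then
            haveI : Fact p.Prime := ⟨hp⟩
            (-(Finset.univ.inf' ⟨0, Finset.mem_univ _⟩ (fun a =>
                I.X.thetaPilot i (e a).1 * logNorm F₀ (e a).1 / localDegree F₀ (e a).1))
              + (packetLogμ p (fun b => (I.σ.localFieldFamily p hp).k (e b))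
                  (packetHull p (fun b => (I.σ.localFieldFamily p hp).k (e b))
                    (logPacket p (fun b => (I.σ.localFieldFamily p hp).k (e b)) : Set _))
                - packetLogμ p (fun b => (I.σ.localFieldFamily p hp).k (e b))
                  (logPacket p (fun b => (I.σ.localFieldFamily p hp).k (e b)) : Set _)))
           else 0) * ∏ b, weight F₀ (e b).1 := by
  rw [← sum_neg_theta_last_eq, ← Finset.sum_add_distrib]
  refine Finset.sum_le_sum fun p hpT => ?_
  have hp' : p.Prime := I.prime_of_mem_supportPrimes hpT
  simp only [dif_pos hp']
  rw [← mul_add, ← Finset.sum_add_distrib]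
  refine mul_le_mul_of_nonneg_left (Finset.sum_le_sum fun i _ => ?_) (one_div_lstar_nonneg I)
  rw [← Finset.sum_add_distrib]
  refine Finset.sum_le_sum fun e _ => ?_
  rw [← add_mul]
  refine mul_le_mul_of_nonneg_right ?_ (prod_weight_nonneg e)
  have h := Finset.inf'_le (fun a => I.X.thetaPilot i (e a).1 * logNorm F₀ (e a).1 / localDegree F₀ (e a).1)
    (Finset.mem_univ (Fin.last ((i : ℕ) + 1)))
  linarith

/-- **REFINED SHALLOW REGIME**: `−deĝ̲(P_q) ≤ lowerWindow + ((l+5)/4)·log π ⟹ Cor312Of I` — a weaker hypothesis than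
`cor312Of_of_shallow`'s (by `neg_ndegLgp_add_defect_le_lowerWindow`: the hull defects `Δ_Λ(I) ≥ 0` and the slot term
are credited). `Cor312Of` is asserted ONLY under this hypothesis. [cite: Mochizuki2012, IUTchIII Cor. 3.12 p. 173–174]
[claim: Mochizuki2012, status: disputed] -/
theorem cor312Of_of_le_lowerWindow
    (h : I.negAbsLogQ ≤
      (∑ p ∈ I.supportPrimes, (1 / (I.X.lstar : ℝ)) * ∑ i : Fin I.X.lstar,
        ∑ e : Fin ((i : ℕ) + 1 + 1) → placesOver F₀ p,
          (if hp : p.Prime then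
            haveI : Fact p.Prime := ⟨hp⟩
            (-(Finset.univ.inf' ⟨0, Finset.mem_univ _⟩ (fun a =>
                I.X.thetaPilot i (e a).1 * logNorm F₀ (e a).1 / localDegree F₀ (e a).1))
              + (packetLogμ p (fun b => (I.σ.localFieldFamily p hp).k (e b))
                  (packetHull p (fun b => (I.σ.localFieldFamily p hp).k (e b))
                    (logPacket p (fun b => (I.σ.localFieldFamily p hp).k (e b)) : Set _))
                - packetLogμ p (fun b => (I.σ.localFieldFamily p hp).k (e b))
                  (logPacket p (fun b => (I.σ.localFieldFamily p hp).k (e b)) : Set _)))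
           else 0) * ∏ b, weight F₀ (e b).1) + ThetaVolumeInput.archLogTheta I.l) :
    I.Cor312Of := by
  have hl := lowerWindow_le_negLogThetaNonarch I
  unfold ThetaVolumeInput.Cor312Of ThetaVolumeInput.negLogTheta
  linarith

/-- **REFINED DEEP REGIME (necessary condition)**: `Cor312Of I ⟹ −deĝ̲(P_q) ≤ upperWindow + ((l+5)/4)·log π`. So
the values of `−deĝ̲(P_q)` on which `Cor312Of I` is not decided by these two kernel facts form a band of width
`D(I)` (`upperWindow_sub_lowerWindow`): inside it the lattice contents decide (c312-3's `cor312Of_iff_of_content`).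
[cite: Mochizuki2012, IUTchIV Thm. 1.10 Steps (v)–(viii) p. 27–30] [claim: Mochizuki2012, status: disputed] -/
theorem negAbsLogQ_le_upperWindow_of_cor312Of (hc : I.Cor312Of) :
    I.negAbsLogQ ≤
      (∑ p ∈ I.supportPrimes, (1 / (I.X.lstar : ℝ)) * ∑ i : Fin I.X.lstar,
        ∑ e : Fin ((i : ℕ) + 1 + 1) → placesOver F₀ p,
          (if hp : p.Prime then
            haveI : Fact p.Prime := ⟨hp⟩
            (-(Finset.univ.inf' ⟨0, Finset.mem_univ _⟩ (fun a =>
                I.X.thetaPilot i (e a).1 * logNorm F₀ (e a).1 / localDegree F₀ (e a).1))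
              + (packetLogμ p (fun b => (I.σ.localFieldFamily p hp).k (e b))
                  (packetHull p (fun b => (I.σ.localFieldFamily p hp).k (e b))
                    (logPacket p (fun b => (I.σ.localFieldFamily p hp).k (e b)) : Set _))
                - packetLogμ p (fun b => (I.σ.localFieldFamily p hp).k (e b))
                  (logPacket p (fun b => (I.σ.localFieldFamily p hp).k (e b)) : Set _))
              + (dSum p (fun b => (I.σ.localFieldFamily p hp).k (e b)) + 1
                  + 4 * ((Finset.univ.filter (fun a : Fin ((i : ℕ) + 1 + 1) =>
                      p - 2 < absRamificationIdx p ((I.σ.localFieldFamily p hp).k (e a)))).card : ℝ) / p)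
                * Real.log p)
           else 0) * ∏ b, weight F₀ (e b).1) + ThetaVolumeInput.archLogTheta I.l := by
  have hu := negLogThetaNonarch_le_upperWindow I
  unfold ThetaVolumeInput.Cor312Of ThetaVolumeInput.negLogTheta at hc
  linarith

end Window

end Summit.ABC.IUTFork.GenuineContent

end
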